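import Literature.Analysis.OperatorTheory.Enflo2023.MinimalVector
import HarnessLib

/-!
# Enflo 2023, v2 eq. (5)–(9): the Lagrange identity `V†(x₀ − Vℓ') = C'ℓ'` and its consequences

Source under adjudication: Per H. Enflo, *On the invariant subspace problem in Hilbert spaces*, arXiv:2305.15442 (v1
2023, v2 2024), bib key `Enflo2023` — a CLAIMED proof of the invariant subspace problem for operators on a separable
Hilbert space.  This file is part of the kernel-tight typing of the manuscript by the b2b-enflo repair cell
(formaliser 1, Part A: v2 eq. (1)–(27), the set-up, the constructions `V_y`, `ℓ'`, `[ ]x₀`, Lemma 1 and Case I/II of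
the main step).  It records what FOLLOWS (proved implications from the manuscript's displayed hypotheses) and, where a
step does not follow, the typed inference together with its refutation.  NOTHING here asserts that the manuscript's
main theorem holds; no declaration concludes the invariant subspace problem for an arbitrary operator.  Value
(BLOCK-2b): theorems / refutations of typed inferences about a text — not progress on the problem.

THE LAGRANGE IDENTITY of the minimal vector of problem (1) (`MinimalVector.lean`) and its consequences,
v2 pp.3–4, eq. (5)–(9).  Here `E`, `H` are complete (the adjoint `V†` is used).

Results (paper ↔ Lean; the paper's `⟨u, v⟩` (linear in `u`) is Mathlib's `⟪v, u⟫_ℂ`):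
* `IsMinimal.kkt`                                 — eq. (5) in operator form: `V† (x₀ - V ℓ') = C' • ℓ'` with a REAL
                                                    `C' ≥ 0` (needs `ℓ' ≠ 0`); `IsMinimal.eq5` is the printed form
                                                    `⟨V r, x₀ - V ℓ'⟩ = C'⟨r, ℓ'⟩ ∀ r`;
* `IsMinimal.eq6`, `IsMinimal.etheta_nonneg`      — eq. (6)/(8): `εθ := ⟨V ℓ', x₀ - V ℓ'⟩ = C' ‖ℓ'‖²` is real and
                                                    `≥ 0` (this REPLACES the rotation argument around eq. (7): no
                                                    "WLOG ⟨Vℓ', x₀ - Vℓ'⟩ real" is needed, it is a theorem);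
* `IsMinimal.eq9`, `IsMinimal.eq9'`               — eq. (9): for any contraction `S` on `E` with `V ∘ S = T ∘ V`
                                                    (`S` = a power of the shift on `ℓ²`, `Vy.lean`), `|⟨T(V ℓ'), x₀ - V ℓ'⟩| ≤ εθ`;
* `IsMinimal.intertwine_pow`, `IsMinimal.opNorm_pow_le_one` — bookkeeping for all powers `T^k`;
* `IsMinimal.inner_eq_zero_of_C_eq_zero`          — the case `C' = 0` of p.3: `x₀ - V ℓ' ⟂ range V`.
Origin: planner-b2b-enflo-1-0, 2026-08-18.  Imports `Literature.Analysis.OperatorTheory.Enflo2023.MinimalVector`.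
-/

noncomputable section

open scoped InnerProductSpace ComplexConjugate
open ContinuousLinearMap
open Literature.Analysis.UnboundedOperators (inner_self_eq_coe_norm_sq)

namespace Literature.Analysis.OperatorTheory.Enflo2023

variable {E H : Type*}
  [NormedAddCommGroup E] [InnerProductSpace ℂ E] [CompleteSpace E]
  [NormedAddCommGroup H] [InnerProductSpace ℂ H] [CompleteSpace H]

namespace IsMinimal

variable {V : E →L[ℂ] H} {x₀ : H} {ε : ℝ} {a : E}


/-- Key perturbation step: if `Re ⟪V†(x₀ - V ℓ'), hh⟫ > 0` then `ℓ' + t • hh` is feasible for a suitable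
`t > 0` (it strictly decreases `‖x₀ - V ·‖`), hence — variational inequality — `Re ⟪ℓ', hh⟫ ≥ 0`. [cite: Enflo2023, v2 p.3, eq. (5)] -/
theorem re_inner_nonneg_of_re_inner_adjoint_pos (h : IsMinimal V x₀ ε a) {hh : E}
    (hpos : 0 < (⟪adjoint V (x₀ - V a), hh⟫_ℂ).re) : 0 ≤ (⟪a, hh⟫_ℂ).re := by
  set g : ℝ := (⟪adjoint V (x₀ - V a), hh⟫_ℂ).re with hg
  have hg' : g = (⟪x₀ - V a, V hh⟫_ℂ).re := by rw [hg, adjoint_inner_left]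
  set q : ℝ := ‖V hh‖ ^ 2 with hq
  have hq0 : 0 ≤ q := by positivity
  have hgq : 0 < g + q := by linarith
  set t : ℝ := g / (g + q) with ht
  have ht0 : 0 < t := div_pos hpos hgq
  have hfeas : a + (t : ℂ) • hh ∈ feasible V x₀ ε := by
    rw [mem_feasible]
    have hexp : ‖x₀ - V (a + (t : ℂ) • hh)‖ ^ 2 = ‖x₀ - V a‖ ^ 2 - 2 * t * g + t ^ 2 * q := by
      have : x₀ - V (a + (t : ℂ) • hh) = (x₀ - V a) - (t : ℂ) • V hh := by
        rw [map_add, map_smul]; abel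
      rw [this, @norm_sub_sq ℂ, inner_smul_right, norm_smul, hg', hq]
      simp only [RCLike.re_to_complex, Complex.re_ofReal_mul, Complex.norm_real, Real.norm_eq_abs,
        abs_of_pos ht0]
      ring
    have htq : t * q < g := by
      rw [ht, div_mul_eq_mul_div, div_lt_iff₀ hgq]
      nlinarith
    have hdec : -2 * t * g + t ^ 2 * q < 0 := by nlinarith
    have h0 : ‖x₀ - V a‖ ^ 2 ≤ ε ^ 2 := pow_le_pow_left₀ (norm_nonneg _) h.norm_sub_le 2
    have hlt : ‖x₀ - V (a + (t : ℂ) • hh)‖ ^ 2 < ε ^ 2 := by linarith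
    have hε := h.eps_nonneg
    by_contra hcon
    push Not at hcon
    have := pow_le_pow_left₀ hε hcon.le 2
    linarith
  have hvi := h.re_inner_nonneg hfeas
  rw [add_sub_cancel_left, inner_smul_right, Complex.re_ofReal_mul] at hvi
  exact (mul_nonneg_iff_of_pos_left ht0).1 hvi

/-- Upgrade of the previous lemma when `d := V†(x₀ - V ℓ') ≠ 0`: `Re ⟪d, hh⟫ ≥ 0 ⇒ Re ⟪ℓ', hh⟫ ≥ 0`
(apply the strict version to `hh + s • d`, `s ↓ 0`). [cite: Enflo2023, v2 p.3, eq. (5)] -/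
theorem re_inner_nonneg_of_re_inner_adjoint_nonneg (h : IsMinimal V x₀ ε a)
    (hd0 : adjoint V (x₀ - V a) ≠ 0) {hh : E}
    (hnn : 0 ≤ (⟪adjoint V (x₀ - V a), hh⟫_ℂ).re) : 0 ≤ (⟪a, hh⟫_ℂ).re := by
  set d := adjoint V (x₀ - V a) with hd
  by_contra hneg
  push Not at hneg
  set R : ℝ := (⟪a, hh⟫_ℂ).re with hR
  set M : ℝ := |(⟪a, d⟫_ℂ).re| + 1 with hM
  have hM0 : 0 < M := by positivity
  set s : ℝ := -R / (2 * M) with hs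
  have hs0 : 0 < s := div_pos (by linarith) (by positivity)
  have hdd : 0 < ‖d‖ ^ 2 := by positivity
  have hpos : 0 < (⟪d, hh + (s : ℂ) • d⟫_ℂ).re := by
    rw [inner_add_right, inner_smul_right, Complex.add_re, Complex.re_ofReal_mul, inner_self_eq_coe_norm_sq, Complex.ofReal_re]
    have : 0 < s * ‖d‖ ^ 2 := mul_pos hs0 hdd
    linarith
  have hvi := h.re_inner_nonneg_of_re_inner_adjoint_pos hpos
  rw [inner_add_right, inner_smul_right, Complex.add_re, Complex.re_ofReal_mul] at hvi
  -- hvi : 0 ≤ R + s * Re⟪a, d⟫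
  have hb : s * (⟪a, d⟫_ℂ).re ≤ s * |(⟪a, d⟫_ℂ).re| := by gcongr; exact le_abs_self _
  have hlt : |(⟪a, d⟫_ℂ).re| < M := by rw [hM]; exact lt_add_one _
  have hc : s * |(⟪a, d⟫_ℂ).re| < -R / 2 := by
    have hR2 : 0 < -R / 2 := by linarith
    calc s * |(⟪a, d⟫_ℂ).re| = (-R / 2) * (|(⟪a, d⟫_ℂ).re| / M) := by rw [hs]; field_simp
      _ < (-R / 2) * 1 := by gcongr; exact (div_lt_one hM0).2 hlt
      _ = -R / 2 := mul_one _
  linarith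

/-- **Eq. (5), operator form (KKT condition).**  At a non-zero minimal solution `ℓ'`,
`V†(x₀ - V ℓ') = C' ℓ'` for a real constant `C' ≥ 0`.  (`C' = 0` exactly when `V†(x₀ - V ℓ') = 0`.) [cite: Enflo2023, v2 p.3, eq. (5)] -/
theorem kkt (h : IsMinimal V x₀ ε a) (ha : a ≠ 0) :
    ∃ C : ℝ, 0 ≤ C ∧ adjoint V (x₀ - V a) = (C : ℂ) • a := by
  by_cases hd0 : adjoint V (x₀ - V a) = 0
  · exact ⟨0, le_rfl, by rw [hd0]; simp⟩
  set d := adjoint V (x₀ - V a) with hd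
  have hdd : 0 < ‖d‖ ^ 2 := by positivity
  set lam : ℝ := (⟪d, a⟫_ℂ).re / ‖d‖ ^ 2 with hlam
  set p : E := a - (lam : ℂ) • d with hp
  have hdp : (⟪d, p⟫_ℂ).re = 0 := by
    rw [hp, inner_sub_right, inner_smul_right, Complex.sub_re, Complex.re_ofReal_mul, inner_self_eq_coe_norm_sq, Complex.ofReal_re, hlam]
    field_simp
    ring
  have h1 : 0 ≤ (⟪a, p⟫_ℂ).re :=
    h.re_inner_nonneg_of_re_inner_adjoint_nonneg hd0 (le_of_eq hdp.symm)
  have h2 : 0 ≤ (⟪a, -p⟫_ℂ).re :=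
    h.re_inner_nonneg_of_re_inner_adjoint_nonneg hd0
      (by rw [inner_neg_right, Complex.neg_re, hdp, neg_zero])
  rw [inner_neg_right, Complex.neg_re] at h2
  have hap : (⟪a, p⟫_ℂ).re = 0 := by linarith
  have hpp : (⟪a, p⟫_ℂ).re = ‖p‖ ^ 2 := by
    have : a = p + (lam : ℂ) • d := by rw [hp]; abel
    conv_lhs => rw [this]
    rw [inner_add_left, inner_smul_left, Complex.add_re, inner_self_eq_coe_norm_sq, Complex.ofReal_re, Complex.conj_ofReal,
      Complex.re_ofReal_mul, hdp, mul_zero, add_zero]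
  have hp0 : p = 0 := by
    have : ‖p‖ ^ 2 = 0 := by linarith
    exact norm_eq_zero.1 (pow_eq_zero_iff two_ne_zero |>.1 this)
  have hal : a = (lam : ℂ) • d := by rw [← sub_eq_zero, ← hp]; exact hp0
  have hlam0 : 0 ≤ lam := by
    have hposd : 0 < (⟪adjoint V (x₀ - V a), d⟫_ℂ).re := by rw [← hd, inner_self_eq_coe_norm_sq, Complex.ofReal_re]; exact hdd
    have := h.re_inner_nonneg_of_re_inner_adjoint_pos hposd
    rw [hlam]
    refine div_nonneg ?_ hdd.le
    rw [← inner_conj_symm, Complex.conj_re]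
    exact this
  have hlam1 : lam ≠ 0 := by
    rintro hzero
    apply ha
    rw [hal, hzero]
    simp
  have hlampos : 0 < lam := lt_of_le_of_ne hlam0 (Ne.symm hlam1)
  refine ⟨1 / lam, by positivity, ?_⟩
  have hlamC : (lam : ℂ) ≠ 0 := by exact_mod_cast hlam1
  have hmul : ((1 / lam : ℝ) : ℂ) * (lam : ℂ) = 1 := by
    push_cast
    exact one_div_mul_cancel hlamC
  rw [hal, smul_smul, hmul, one_smul]

/-- **Eq. (5), printed form**: `⟨V r, x₀ - V ℓ'⟩ = C'⟨r, ℓ'⟩` for every `r`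
(paper's `⟨u, v⟩` = Mathlib's `⟪v, u⟫_ℂ`). [cite: Enflo2023, v2 p.3, eq. (5)] -/
theorem eq5 {C : ℝ} (hC : adjoint V (x₀ - V a) = (C : ℂ) • a) (r : E) :
    ⟪x₀ - V a, V r⟫_ℂ = (C : ℂ) * ⟪a, r⟫_ℂ := by
  rw [← adjoint_inner_left, hC, inner_smul_left, Complex.conj_ofReal]

/-- **Eq. (6)/(8)**: `εθ := ⟨V ℓ', x₀ - V ℓ'⟩ = C' ‖ℓ'‖²`; in particular it is real and `≥ 0`
(the paper argues this separately via eq. (7) and Figure 1). [cite: Enflo2023, v2 pp.3–4, eq. (6), (8)] -/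
theorem eq6 {C : ℝ} (hC : adjoint V (x₀ - V a) = (C : ℂ) • a) :
    ⟪x₀ - V a, V a⟫_ℂ = ((C * ‖a‖ ^ 2 : ℝ) : ℂ) := by
  rw [eq5 hC a, inner_self_eq_coe_norm_sq]
  push_cast
  ring

/-- `εθ = ⟨V ℓ', x₀ − V ℓ'⟩` is REAL — a theorem, replacing the manuscript's "WLOG real" rotation argument around (7). [cite: Enflo2023, v2 p.4, eq. (7)–(8)] -/
theorem etheta_im_eq_zero {C : ℝ} (hC : adjoint V (x₀ - V a) = (C : ℂ) • a) :
    (⟪x₀ - V a, V a⟫_ℂ).im = 0 := by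
  rw [eq6 hC, Complex.ofReal_im]

/-- `εθ = ⟨V ℓ', x₀ − V ℓ'⟩ ≥ 0` (eq. (8)), from `C' ≥ 0`. [cite: Enflo2023, v2 p.4, eq. (8)] -/
theorem etheta_nonneg {C : ℝ} (hC0 : 0 ≤ C) (hC : adjoint V (x₀ - V a) = (C : ℂ) • a) :
    0 ≤ (⟪x₀ - V a, V a⟫_ℂ).re := by
  rw [eq6 hC, Complex.ofReal_re]
  positivity

/-- **Eq. (9)**: if `S` is a contraction of `E` intertwined with `T` by `V` (`V ∘ S = T ∘ V`; on `ℓ²`,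
`S` = the `k`-th power of the right shift and `T ↦ T^k`), then `|⟨T (V ℓ'), x₀ - V ℓ'⟩| ≤ C'‖ℓ'‖² = εθ`. [cite: Enflo2023, v2 p.4, eq. (9)] -/
theorem eq9 {C : ℝ} (hC0 : 0 ≤ C) (hC : adjoint V (x₀ - V a) = (C : ℂ) • a)
    (S : E →L[ℂ] E) (hS : ‖S‖ ≤ 1) (T : H →L[ℂ] H) (hVS : ∀ b, V (S b) = T (V b)) :
    ‖⟪x₀ - V a, T (V a)⟫_ℂ‖ ≤ C * ‖a‖ ^ 2 := by
  rw [← hVS, eq5 hC (S a), norm_mul, Complex.norm_real, Real.norm_of_nonneg hC0]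
  have h1 : ‖⟪a, S a⟫_ℂ‖ ≤ ‖a‖ * ‖S a‖ := norm_inner_le_norm a (S a)
  have h2 : ‖S a‖ ≤ ‖a‖ := by
    calc ‖S a‖ ≤ ‖S‖ * ‖a‖ := S.le_opNorm a
      _ ≤ 1 * ‖a‖ := by gcongr
      _ = ‖a‖ := one_mul _
  calc C * ‖⟪a, S a⟫_ℂ‖ ≤ C * (‖a‖ * ‖a‖) := by
        gcongr
        exact h1.trans (by gcongr)
    _ = C * ‖a‖ ^ 2 := by ring

/-- Same as `eq9` with the bound written as `εθ = Re ⟨V ℓ', x₀ - V ℓ'⟩`. [cite: Enflo2023, v2 p.4, eq. (9)] -/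
theorem eq9' {C : ℝ} (hC0 : 0 ≤ C) (hC : adjoint V (x₀ - V a) = (C : ℂ) • a)
    (S : E →L[ℂ] E) (hS : ‖S‖ ≤ 1) (T : H →L[ℂ] H) (hVS : ∀ b, V (S b) = T (V b)) :
    ‖⟪x₀ - V a, T (V a)⟫_ℂ‖ ≤ (⟪x₀ - V a, V a⟫_ℂ).re := by
  rw [eq6 hC, Complex.ofReal_re]
  exact eq9 hC0 hC S hS T hVS

omit [CompleteSpace E] [CompleteSpace H] in
/-- Powers: if `V ∘ S = T ∘ V` then `V ∘ S^k = T^k ∘ V`, and a contraction's powers are contractions;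
so `eq9` applies to every `T^k`, `k ≥ 1` (and trivially `k = 0`). [folklore] -/
lemma intertwine_pow (S : E →L[ℂ] E) (T : H →L[ℂ] H) (hVS : ∀ b, V (S b) = T (V b)) (k : ℕ) :
    ∀ b, V ((S ^ k) b) = (T ^ k) (V b) := by
  induction k with
  | zero => intro b; simp
  | succ k ih =>
      intro b
      rw [pow_succ, pow_succ]
      show V ((S ^ k) (S b)) = (T ^ k) (T (V b))
      rw [ih, hVS]

/-- Powers of a contraction are contractions: `‖S‖ ≤ 1 ⇒ ‖S^k‖ ≤ 1`. [folklore] -/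
lemma opNorm_pow_le_one (S : E →L[ℂ] E) (hS : ‖S‖ ≤ 1) (k : ℕ) : ‖S ^ k‖ ≤ 1 := by
  induction k with
  | zero => rw [pow_zero, ContinuousLinearMap.one_def]; exact ContinuousLinearMap.norm_id_le
  | succ k ih =>
      rw [pow_succ]
      calc ‖S ^ k * S‖ ≤ ‖S ^ k‖ * ‖S‖ := norm_mul_le _ _
        _ ≤ 1 * 1 := by gcongr
        _ = 1 := one_mul _

/-- The case `C' = 0` (v2 p.3): then `x₀ - V ℓ'` is orthogonal to the whole range of `V`. [cite: Enflo2023, v2 p.3, case C' = 0] -/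
theorem inner_eq_zero_of_C_eq_zero (hC : adjoint V (x₀ - V a) = ((0 : ℝ) : ℂ) • a) (r : E) :
    ⟪x₀ - V a, V r⟫_ℂ = 0 := by
  rw [eq5 hC r]; simp

end IsMinimal

end Literature.Analysis.OperatorTheory.Enflo2023

end
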